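import Summits.CriticalPhenomena.PercolationContinuityZ3.Theorems.PercNearOneGluingNoHeavyLowerTailSunflowerRainbowCertificate
import HarnessLib
import HarnessLib.Audit

/-!
# `NoHeavyLowerTail` (crux stmt-CriticalPhenomena-4575), abstract sunflower cubic: the CUBE-DUAL CERTIFICATE IS TRIANGULAR ALONG THE
# PRODUCT ORDER — `⟨k_a, rbVec c⟩ = 0` whenever the rainbow `c` lies strictly below `a`; hence the two-stage vectors of any family of
# rainbows without "incomparable defects" (in particular of any chain) are linearly independent

Support file (seat `prim-l12-p2` gen 23; `--supports stmt-CriticalPhenomena-4575`).  No `sorry`, no new definitions.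
Memo: run/shared/lean/prim/prim-l12/prim-l12-p2/FINDING-g23-BILINEAR-CERTIFICATE.md (§1, §6).

CONTEXT.  Gen 19 (`…SunflowerRainbowReadingVectors`) built for every rainbow `a = (Q1,Q2,Q3)` the cube-dual certificate functional
`k_a = certFun a ∈ GF(2)^{sup}`, `k_a = Σ_{S,O} N_{Q1ᶜ}(S,Q3)·M_{Q1∪Q2}(Q2,O)·probe_{S,O}`, and proved the EXACT DIAGONAL `⟨k_a, rbVec a⟩ = 1`
(`certFun_rbVec_diag`).  `RainbowKernelIndependence` (gen 18, OPEN) would follow if the matrix `P(a,c) = ⟨k_a, rbVec c⟩` were unitriangular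
in some linear order of the rainbows.  CENSUS (gen 23, `code/certfun.c`): the off-diagonal support of `P` NEVER contains a pair with `c` strictly
below `a` in the product order `RbBelow` (`Q1 ⊆, Q3 ⊆`): 0 of 533 684 pairs on all-petals-non-intersecting 7-point sunflowers, 0 of 63 225 004 on the
composition family `θ∘gadgets` on ≤ 7 points, 0 of 1 804 410 on `CS(3,3,3)` and its neighbours; the defects sit strictly above (harmless) or at
INCOMPARABLE pairs (79 + 60, 3 229 + 64 837, 108 + 432 respectively) — and `P` is singular in 1 181 of 655 077 composition instances, so the
incomparable defects are genuine.

THIS FILE proves the census law.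
* `Sunflower.certFun_rbVec_below` — for rainbows `c` STRICTLY BELOW `a` (`RbBelow c a`): `⟨certFun a, rbVec c⟩ = 0`.
  Proof.  Each probe `(S,O)` of `a` reads `rbVec c` exactly as `[lab E_O = 0]·m_c(S)·n_c(O)` with `E_O = O ∪ (Q3a ∖ Q3c)`,
  `m_c(S) = #{R' ∈ B : S ⊆ R' ⊆ Q3c}`, `n_c(O) = #{R ∈ A : Q1c ⊆ R ⊆ (Q1a∪Q2a)∖O}`: the `M`-row probes need the slice condition
  `lab (Sᶜ∖Q1c) = 4`, automatic below `a`; the `N`-column probes need `lab E_O = 0`; and when `lab E_O ≠ 0` then `E_O ⊆ Q2c` has label `2`,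
  every probe third block contains it, so only `N`-column probes occur and they read `0`.  Hence the pairing factors as
  `[Σ_S N_{Q1aᶜ}(S,Q3a) M(Q3c,S)] · [Σ_{O : lab E_O = 0} M_{Q1a∪Q2a}(Q2a,O) N(O,·)]`; the first factor is the OFF-DIAGONAL entry `(Q3c,Q3a)` of
  the key identity `M·N ≡ I` in the cube `Q1aᶜ` (`crossKeyGen`; its junk term vanishes because `Q1aᶜ ∖ Q3c ⊆ Q2c` is not a kernel set), i.e.
  `[Q3c = Q3a]`; and if `Q3c = Q3a` then `E_O = O`, the second factor is the entry `(Q2a, (Q1a∪Q2a)∖Q1c)` of `M·N ≡ I` in the cube `Q1a ∪ Q2a`,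
  i.e. `[Q1c = Q1a] = 0`.
* `Sunflower.rbVec_linearIndependent_of_certFun_incomparable` — if, on a set `X` of rainbows, `⟨certFun a, rbVec c⟩ = 0` for all INCOMPARABLE
  `a ≠ c` in `X`, then `{rbVec c}_{c ∈ X}` is linearly independent (leading-term lemma of gen 22 with weight `|Q1|+|Q3|`: `k_a` kills every
  `rbVec c` with `c` not strictly above `a`).  In particular the two-stage vectors of any `RbBelow`-CHAIN of rainbows are independent, and
* `Sunflower.ZH_nonneg_of_certFun_incomparable` — ★ (`0 ≤ ZH`) holds for every sunflower whose cube-dual certificate matrix has no incomparable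
  defects (gen 20's `ZH_nonneg_of_rbVec_linearIndependent`).  `RainbowKernelIndependence` is thus EXACTLY the problem of the incomparable pairs.
-/

namespace Summit.CriticalPhenomena.PercolationContinuityZ3.Theorems.SunflowerPartition

open Finset

variable {α : Type*} [Fintype α] [DecidableEq α]

namespace Sunflower

variable (F : Sunflower α)

/-- **THE CUBE-DUAL CERTIFICATE IS TRIANGULAR ALONG THE PRODUCT ORDER** (this work): for rainbows `c` strictly below `a`
(`Q1c ⊆ Q1a`, `Q3c ⊆ Q3a`, `c ≠ a`), `⟨certFun a, rbVec c⟩ = 0`. [this work] -/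
theorem certFun_rbVec_below {a c : Finset α × Finset α} (ha : a ∈ F.dem) (har : F.IsRainbow a) (hc : c ∈ F.dem) (hcr : F.IsRainbow c)
    (hb : RbBelow c a) : (∑ σ ∈ F.sup, F.certFun a σ * F.rbVec c σ) = 0 := by
  obtain ⟨hdisj, hQ1, hQ2, hQ3l⟩ := F.dem_rainbow_facts ha har
  obtain ⟨hdisjc, hQ1c, hQ2c, hP3⟩ := F.dem_rainbow_facts hc hcr
  obtain ⟨hb1, hb3, hbne⟩ := hb
  -- names
  set Q3 := (a.1 ∪ a.2)ᶜ with hQ3def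
  set P3 := (c.1 ∪ c.2)ᶜ with hP3def
  set filtS := (Q3).powerset.filter (fun S => F.lab S = 0 ∧ F.lab (a.1ᶜ \ S) = 4) with hfS
  set filtO := (a.2).powerset.filter (fun O => F.lab O = 0 ∧ F.lab ((a.1 ∪ a.2) \ O) = 4) with hfO
  -- the `M`/`N` entries of `c` read by the probes of `a`
  let mc : Finset α → ZMod 2 := fun S =>
    ∑ R' ∈ (Finset.univ : Finset α).powerset, (if F.lab R' = 0 ∧ S ⊆ R' ∧ R' ⊆ P3 then (1 : ZMod 2) else 0)
  let nc : Finset α → ZMod 2 := fun O =>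
    ∑ R ∈ (Finset.univ : Finset α).powerset, (if F.lab R = 4 ∧ c.1 ⊆ R ∧ R ⊆ (a.1 ∪ a.2) \ O then (1 : ZMod 2) else 0)
  -- basic set facts
  have hUQ2 : (a.1 ∪ a.2) \ a.2 = a.1 := by
    ext x; simp only [mem_sdiff, mem_union]
    constructor
    · rintro ⟨h | h, h2⟩
      · exact h
      · exact absurd h h2
    · intro h; exact ⟨Or.inl h, fun h2 => (Finset.disjoint_left.1 hdisj) h h2⟩
  have hU1Q3 : a.1ᶜ \ Q3 = a.2 := by
    ext x; simp only [hQ3def, mem_sdiff, mem_compl, mem_union, not_or, not_and, not_not]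
    constructor
    · rintro ⟨h1, h⟩; exact h h1
    · intro h2; exact ⟨fun h1 => (Finset.disjoint_left.1 hdisj) h1 h2, fun _ => h2⟩
  have hQ3U1 : Q3 ⊆ a.1ᶜ := by
    intro x hx; rw [hQ3def, mem_compl, mem_union, not_or] at hx; exact mem_compl.2 hx.1
  have hP3U1 : P3 ⊆ a.1ᶜ := hb3.trans hQ3U1
  -- `c.2 = (c.1 ∪ P3)ᶜ`: anything outside `c.1` and outside `P3` lies in `c.2`
  have mem_c2 : ∀ {x}, x ∉ c.1 → x ∉ P3 → x ∈ c.2 := by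
    intro x h1 h3
    rw [hP3def, mem_compl, mem_union, not_or, not_and_or, not_not, not_not] at h3
    rcases h3 with h | h
    · exact absurd h h1
    · exact h
  -- STEP 1: exchange the sums
  have step1 : (∑ σ ∈ F.sup, F.certFun a σ * F.rbVec c σ)
      = ∑ S ∈ filtS, ∑ O ∈ filtO, F.certN a S * F.certM a O * (∑ σ ∈ F.sup, F.certProbe a S O σ * F.rbVec c σ) := by
    unfold certFun
    rw [show (∑ σ ∈ F.sup, (∑ S ∈ filtS, ∑ O ∈ filtO, F.certN a S * F.certM a O * F.certProbe a S O σ) * F.rbVec c σ)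
        = ∑ σ ∈ F.sup, ∑ S ∈ filtS, ∑ O ∈ filtO, F.certN a S * F.certM a O * (F.certProbe a S O σ * F.rbVec c σ) from
      sum_congr rfl fun σ _ => by
        rw [Finset.sum_mul]; refine sum_congr rfl fun S _ => ?_
        rw [Finset.sum_mul]; refine sum_congr rfl fun O _ => ?_
        ring]
    rw [Finset.sum_comm]
    refine sum_congr rfl fun S _ => ?_
    rw [Finset.sum_comm]
    refine sum_congr rfl fun O _ => ?_
    rw [Finset.mul_sum]
  rw [step1]
  -- STEP 2: each probe of `a` reads `rbVec c` as `[lab E_O = 0] · m_c(S) · n_c(O)`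
  have step2 : ∀ S ∈ filtS, ∀ O ∈ filtO,
      (∑ σ ∈ F.sup, F.certProbe a S O σ * F.rbVec c σ)
        = if F.lab (((a.1 ∪ a.2) \ O)ᶜ \ P3) = 0 then mc S * nc O else 0 := by
    intro S hS O hO
    obtain ⟨hSQ3, hS0, hS4⟩ := mem_filter.1 hS
    obtain ⟨hOQ2, hO0, hO4⟩ := mem_filter.1 hO
    rw [mem_powerset] at hSQ3 hOQ2
    set X := (a.1 ∪ a.2) \ O with hXdef
    set Z := (Q3 \ S) ∪ O with hZdef
    -- set identities (as in `certFun_rbVec_diag`)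
    have hSO : Disjoint S O := by
      refine Finset.disjoint_left.2 fun x hxS hxO => ?_
      have := hSQ3 hxS; rw [hQ3def, mem_compl, mem_union, not_or] at this; exact this.2 (hOQ2 hxO)
    have hXc : Xᶜ = Q3 ∪ O := by
      ext x; simp only [hXdef, hQ3def, mem_compl, mem_sdiff, mem_union, not_and, not_not]
      constructor
      · intro h; by_cases hx : x ∈ a.1 ∨ x ∈ a.2
        · exact Or.inr (h hx)
        · exact Or.inl hx
      · rintro (h | h)
        · exact fun hx => absurd hx h
        · exact fun _ => h
    have hXcS : Xᶜ \ S = Z := by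
      rw [hXc, hZdef]; ext x; simp only [mem_sdiff, mem_union]
      constructor
      · rintro ⟨h | h, hnS⟩
        · exact Or.inl ⟨h, hnS⟩
        · exact Or.inr h
      · rintro (⟨h, hnS⟩ | h)
        · exact ⟨Or.inl h, hnS⟩
        · exact ⟨Or.inr h, fun hxS => (Finset.disjoint_left.1 hSO) hxS h⟩
    have hZSc : Z ⊆ Sᶜ := by
      intro x hx; rw [mem_compl]; intro hxS; rw [hZdef, mem_union] at hx
      rcases hx with h | h
      · exact (mem_sdiff.1 h).2 hxS
      · exact (Finset.disjoint_left.1 hSO) hxS h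
    have h1X : a.1 ⊆ X := by
      intro x hx; rw [hXdef, mem_sdiff]
      exact ⟨mem_union_left _ hx, fun hxO => (Finset.disjoint_left.1 hdisj) hx (hOQ2 hxO)⟩
    have hc1X : c.1 ⊆ X := hb1.trans h1X
    have hQ3Xc : Q3 ⊆ Xᶜ := by rw [hXc]; exact subset_union_left
    have hP3Xc : P3 ⊆ Xᶜ := hb3.trans hQ3Xc
    have hScZ : Sᶜ \ Z = X := by
      ext x
      constructor
      · intro hx
        obtain ⟨hxS, hxZ⟩ := mem_sdiff.1 hx
        rw [mem_compl] at hxS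
        rw [hZdef, mem_union, not_or, mem_sdiff] at hxZ
        have hxQ3 : x ∉ Q3 := fun h => hxZ.1 ⟨h, hxS⟩
        rw [hQ3def, mem_compl, not_not] at hxQ3
        rw [hXdef, mem_sdiff]; exact ⟨hxQ3, hxZ.2⟩
      · intro hx
        obtain ⟨hU, hxO⟩ := mem_sdiff.1 (show x ∈ (a.1 ∪ a.2) \ O by rw [hXdef] at hx; exact hx)
        have hxQ3 : x ∉ Q3 := by rw [hQ3def, mem_compl, not_not]; exact hU
        refine mem_sdiff.2 ⟨mem_compl.2 fun hxS => hxQ3 (hSQ3 hxS), ?_⟩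
        rw [hZdef, mem_union, not_or, mem_sdiff]
        exact ⟨fun h => hxQ3 h.1, hxO⟩
    have hScQ1 : Sᶜ \ a.1 = a.1ᶜ \ S := by
      ext x; simp only [mem_sdiff, mem_compl]; tauto
    have hXSc : X ⊆ Sᶜ := by rw [← hScZ]; exact sdiff_subset
    -- the defect set `E = Xᶜ ∖ P3 = O ∪ (Q3 ∖ P3)` sits inside `Q2c`
    have hEc2 : Xᶜ \ P3 ⊆ c.2 := by
      intro x hx
      obtain ⟨hxX, hxP⟩ := mem_sdiff.1 hx
      rw [mem_compl] at hxX
      exact mem_c2 (fun h1 => hxX (hc1X h1)) hxP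
    have hE02 : F.lab (Xᶜ \ P3) = 2 ∨ F.lab (Xᶜ \ P3) = 0 := by
      have := F.lab_subset hEc2 (by rw [hQ2c]; decide)
      rw [hQ2c] at this; exact this
    -- the canonical values
    have hmc_zero : ¬ S ⊆ P3 → mc S = 0 := fun h =>
      sum_eq_zero fun R' _ => if_neg fun h' => h (h'.2.1.trans h'.2.2)
    unfold certProbe
    rw [show ((a.1 ∪ a.2)ᶜ \ S) ∪ O = Z from by rw [hZdef], show (a.1 ∪ a.2) \ O = X from by rw [hXdef]]
    by_cases hC : F.lab (Xᶜ \ P3) = 0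
    · -- all probes read `m_c(S) · n_c(O)`
      rw [if_pos hC]
      by_cases htype : F.lab Z = 4 ∨ F.lab Z = 1 ∨ F.lab Z = 2
      · -- `N`-column probe of column `S` at kernel spectator `X`
        simp only [htype, ite_true, ite_mul, zero_mul]
        rw [F.rbVec_read_kernel hc hcr (X := X) (Y'' := S) hO4 (hSQ3.trans hQ3Xc) (by rw [hXcS]; exact htype)]
        rw [if_pos ⟨hO4, hc1X, hP3Xc, hC⟩]
        show _ = mc S * nc O
        rw [F.sum_pow_to 0 S P3 Xᶜ hP3Xc, show mc S = _ from F.sum_pow_to 0 S P3 Finset.univ (subset_univ _), mul_comm]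
      · -- `M`-row probe of row `Z` at bottom spectator `S`
        have hZ4 : F.lab Z ≠ 4 := fun h => htype (Or.inl h)
        have hZ1 : F.lab Z ≠ 1 := fun h => htype (Or.inr (Or.inl h))
        simp only [htype, ite_false, ite_mul, zero_mul]
        rw [F.rbVec_read_bottom hc hcr hS0 hZSc hZ1 hZ4]
        by_cases hSP3 : S ⊆ P3
        · have hS4c : F.lab (Sᶜ \ c.1) = 4 := by
            refine F.lab_eq_four_of_subset (show Sᶜ \ a.1 ⊆ Sᶜ \ c.1 from ?_) (by rw [hScQ1]; exact hS4)
            intro x hx; obtain ⟨h1, h2⟩ := mem_sdiff.1 hx; exact mem_sdiff.2 ⟨h1, fun h => h2 (hb1 h)⟩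
          rw [if_pos ⟨hS0, hSP3, hS4c⟩, hScZ, if_pos hO4]
          show _ = mc S * nc O
          rw [F.sum_pow_to 4 c.1 X Sᶜ hXSc, show nc O = _ from F.sum_pow_to 4 c.1 X Finset.univ (subset_univ _)]
        · rw [if_neg (fun h => hSP3 h.2.1), hmc_zero hSP3, zero_mul]
    · -- `lab E = 2`: only `N`-column probes occur, and they read `0`
      rw [if_neg hC]
      have hE2 : F.lab (Xᶜ \ P3) = 2 := by
        rcases hE02 with h | h
        · exact h
        · exact absurd h hC
      by_cases htype : F.lab Z = 4 ∨ F.lab Z = 1 ∨ F.lab Z = 2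
      · simp only [htype, ite_true, ite_mul, zero_mul]
        rw [F.rbVec_read_kernel hc hcr (X := X) (Y'' := S) hO4 (hSQ3.trans hQ3Xc) (by rw [hXcS]; exact htype)]
        rw [if_neg (fun h => hC h.2.2.2)]
      · have hZ4 : F.lab Z ≠ 4 := fun h => htype (Or.inl h)
        have hZ1 : F.lab Z ≠ 1 := fun h => htype (Or.inr (Or.inl h))
        simp only [htype, ite_false, ite_mul, zero_mul]
        rw [F.rbVec_read_bottom hc hcr hS0 hZSc hZ1 hZ4]
        by_cases hSP3 : S ⊆ P3
        · -- then `E ⊆ Z`, so `lab Z ∈ {2,4}`: this probe type does not occur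
          exfalso
          have hEZ : Xᶜ \ P3 ⊆ Z := by
            rw [← hXcS]
            intro x hx; obtain ⟨h1, h2⟩ := mem_sdiff.1 hx; exact mem_sdiff.2 ⟨h1, fun h => h2 (hSP3 h)⟩
          have := F.lab_superset hEZ (by rw [hE2]; decide)
          rw [hE2] at this
          rcases this with h | h
          · exact htype (Or.inr (Or.inr h))
          · exact hZ4 h
        · rw [if_neg (fun h => hSP3 h.2.1)]
  rw [sum_congr rfl fun S hS => sum_congr rfl fun O hO => by rw [step2 S hS O hO]]
  -- STEP 3: factor
  rw [show (∑ S ∈ filtS, ∑ O ∈ filtO,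
        F.certN a S * F.certM a O * (if F.lab (((a.1 ∪ a.2) \ O)ᶜ \ P3) = 0 then mc S * nc O else 0))
      = ∑ S ∈ filtS, ∑ O ∈ filtO, (mc S * F.certN a S) *
          (F.certM a O * (if F.lab (((a.1 ∪ a.2) \ O)ᶜ \ P3) = 0 then nc O else 0)) from
    sum_congr rfl fun S _ => sum_congr rfl fun O _ => by
      by_cases h : F.lab (((a.1 ∪ a.2) \ O)ᶜ \ P3) = 0
      · rw [if_pos h, if_pos h]; ring
      · rw [if_neg h, if_neg h]; ring]
  rw [← Finset.sum_mul_sum]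
  -- STEP 4: `Σ_S M(Q3c,S) N(S,Q3a) = [Q3c = Q3a]` in the cube `Q1aᶜ` (off-diagonal entry of `M·N ≡ I`, junk-free below `a`)
  have hmc_gen : ∀ S, mc S = ∑ R' ∈ (a.1ᶜ).powerset, (if F.lab R' = 0 ∧ S ⊆ R' ∧ R' ⊆ P3 then (1 : ZMod 2) else 0) := by
    intro S
    show (∑ R' ∈ (Finset.univ : Finset α).powerset, (if F.lab R' = 0 ∧ S ⊆ R' ∧ R' ⊆ P3 then (1 : ZMod 2) else 0)) = _
    rw [F.sum_pow_to 0 S P3 Finset.univ (subset_univ _), F.sum_pow_to 0 S P3 a.1ᶜ hP3U1]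
  have step4 : (∑ S ∈ filtS, mc S * F.certN a S) = if P3 = Q3 then 1 else 0 := by
    have hjunk : F.lab (a.1ᶜ \ P3) ≠ 4 := by
      have hsub : a.1ᶜ \ P3 ⊆ c.2 := by
        intro x hx; obtain ⟨h1, h3⟩ := mem_sdiff.1 hx; rw [mem_compl] at h1
        exact mem_c2 (fun h => h1 (hb1 h)) h3
      have := F.lab_subset hsub (by rw [hQ2c]; decide)
      rw [hQ2c] at this
      rcases this with h | h <;> rw [h] <;> decide
    have key := F.crossKeyGen a.1ᶜ (Y := P3) (Y'' := Q3) hP3U1 hQ3U1 (by rw [hP3]; decide) (by rw [hQ3l]; decide)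
      (by rw [hU1Q3, hQ2]; decide) (by rw [hU1Q3, hQ2]; decide) (by rw [hU1Q3, hQ2, hP3]; decide)
    rw [if_neg hjunk, add_zero] at key
    rw [show (∑ S ∈ filtS, mc S * F.certN a S)
        = ∑ S ∈ filtS, (∑ R' ∈ (a.1ᶜ).powerset, (if F.lab R' = 0 ∧ S ⊆ R' ∧ R' ⊆ P3 then (1 : ZMod 2) else 0)) * F.certN a S from
      sum_congr rfl fun S _ => by rw [hmc_gen S], ← key]
    refine Finset.sum_subset (fun S hS => mem_powerset.2 ((mem_powerset.1 (mem_filter.1 hS).1).trans hQ3U1)) fun S hSW hSf => ?_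
    -- outside the filter the summand vanishes
    by_cases hSQ3 : S ⊆ Q3
    · by_cases hS0 : F.lab S = 0
      · have hS4 : F.lab (a.1ᶜ \ S) ≠ 4 := fun h => hSf (mem_filter.2 ⟨mem_powerset.2 hSQ3, hS0, h⟩)
        show (∑ R' ∈ (a.1ᶜ).powerset, (if F.lab R' = 0 ∧ S ⊆ R' ∧ R' ⊆ P3 then (1 : ZMod 2) else 0)) * F.certN a S = 0
        unfold certN
        rw [show a.1ᶜ \ (a.1 ∪ a.2)ᶜ = a.1ᶜ \ Q3 from rfl, F.crossN_eq_zero_of_lab_ne a.1ᶜ (Y'' := Q3) hS4, mul_zero]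
      · show (∑ R' ∈ (a.1ᶜ).powerset, (if F.lab R' = 0 ∧ S ⊆ R' ∧ R' ⊆ P3 then (1 : ZMod 2) else 0)) * F.certN a S = 0
        rw [F.crossM_eq_zero_of_lab_ne a.1ᶜ (Y := P3) hS0, zero_mul]
    · show (∑ R' ∈ (a.1ᶜ).powerset, (if F.lab R' = 0 ∧ S ⊆ R' ∧ R' ⊆ P3 then (1 : ZMod 2) else 0)) * F.certN a S = 0
      have hSP3 : ¬ S ⊆ P3 := fun h => hSQ3 (h.trans hb3)
      rw [show (∑ R' ∈ (a.1ᶜ).powerset, (if F.lab R' = 0 ∧ S ⊆ R' ∧ R' ⊆ P3 then (1 : ZMod 2) else 0)) = 0 from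
        sum_eq_zero fun R' _ => if_neg fun h => hSP3 (h.2.1.trans h.2.2), zero_mul]
  rw [step4]
  by_cases hPQ : P3 = Q3
  · -- STEP 5: `Q3c = Q3a`, hence `Q1c ≠ Q1a`; then `E_O = O` and `Σ_O M(Q2a,O) N(O,(Q1a∪Q2a)∖Q1c) = [Q1c = Q1a] = 0` in the cube `Q1a ∪ Q2a`
    rw [if_pos hPQ, one_mul]
    have hne1 : c.1 ≠ a.1 := by
      rcases hbne with h | h
      · exact h
      · exact absurd hPQ h
    have hc1W : c.1 ⊆ a.1 ∪ a.2 := hb1.trans subset_union_left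
    have hWY : (a.1 ∪ a.2) \ ((a.1 ∪ a.2) \ c.1) = c.1 := Finset.sdiff_sdiff_eq_self hc1W
    have hY''2 : F.lab ((a.1 ∪ a.2) \ c.1) = 2 ∨ F.lab ((a.1 ∪ a.2) \ c.1) = 4 := by
      have hsub : a.2 ⊆ (a.1 ∪ a.2) \ c.1 := by
        intro x hx; exact mem_sdiff.2 ⟨mem_union_right _ hx, fun h1 => (Finset.disjoint_left.1 hdisj) (hb1 h1) hx⟩
      have := F.lab_superset hsub (by rw [hQ2]; decide)
      rw [hQ2] at this; exact this
    have hneY : a.2 ≠ (a.1 ∪ a.2) \ c.1 := by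
      intro heq
      apply hne1
      refine Finset.Subset.antisymm hb1 fun x hx => ?_
      by_contra hxc
      have hx2 : x ∈ a.2 := by rw [heq]; exact mem_sdiff.2 ⟨mem_union_left _ hx, hxc⟩
      exact (Finset.disjoint_left.1 hdisj) hx hx2
    -- on the filter, `E_O = O` has label `0` and `n_c(O)` is the `N`-entry of the cube `Q1a ∪ Q2a`
    have hsum5 : (∑ O ∈ filtO, F.certM a O * (if F.lab (((a.1 ∪ a.2) \ O)ᶜ \ P3) = 0 then nc O else 0))
        = ∑ O ∈ filtO, (∑ R' ∈ (a.1 ∪ a.2).powerset, (if F.lab R' = 0 ∧ O ⊆ R' ∧ R' ⊆ a.2 then (1 : ZMod 2) else 0)) *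
            (∑ R ∈ (a.1 ∪ a.2).powerset, (if F.lab R = 4 ∧ c.1 ⊆ R ∧ R ⊆ (a.1 ∪ a.2) \ O then (1 : ZMod 2) else 0)) := by
      refine sum_congr rfl fun O hO => ?_
      obtain ⟨hOQ2, hO0, -⟩ := mem_filter.1 hO
      rw [mem_powerset] at hOQ2
      have hXcP3 : ((a.1 ∪ a.2) \ O)ᶜ \ P3 = O := by
        rw [hPQ]
        ext x
        have hxO2 : x ∈ O → x ∈ a.2 := fun h => hOQ2 h
        simp only [hQ3def, mem_sdiff, mem_compl, mem_union]
        tauto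
      rw [hXcP3, if_pos hO0]
      unfold certM
      congr 1
      show (∑ R ∈ (Finset.univ : Finset α).powerset,
          (if F.lab R = 4 ∧ c.1 ⊆ R ∧ R ⊆ (a.1 ∪ a.2) \ O then (1 : ZMod 2) else 0)) = _
      rw [F.sum_pow_to 4 c.1 ((a.1 ∪ a.2) \ O) Finset.univ (subset_univ _),
        F.sum_pow_to 4 c.1 ((a.1 ∪ a.2) \ O) (a.1 ∪ a.2) sdiff_subset]
    have key := F.crossKeyGen (a.1 ∪ a.2) (Y := a.2) (Y'' := (a.1 ∪ a.2) \ c.1) subset_union_right sdiff_subset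
      (by rw [hQ2]; decide) (by rcases hY''2 with h | h <;> rw [h] <;> decide)
      (by rw [hWY, hQ1c]; decide) (by rw [hWY, hQ1c]; decide) (by rw [hWY, hQ1c, hQ2]; decide)
    rw [if_neg hneY, hUQ2, hQ1, if_neg (show ¬ ((1 : Fin 5) = 4) by decide), zero_add, hWY] at key
    have hvan : ∀ O ∈ (a.1 ∪ a.2).powerset, O ∉ filtO →
        (∑ R' ∈ (a.1 ∪ a.2).powerset, (if F.lab R' = 0 ∧ O ⊆ R' ∧ R' ⊆ a.2 then (1 : ZMod 2) else 0)) *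
          (∑ R ∈ (a.1 ∪ a.2).powerset, (if F.lab R = 4 ∧ c.1 ⊆ R ∧ R ⊆ (a.1 ∪ a.2) \ O then (1 : ZMod 2) else 0)) = 0 := by
      intro O hOW hOf
      by_cases hOQ2 : O ⊆ a.2
      · by_cases hO0 : F.lab O = 0
        · have hO4 : F.lab ((a.1 ∪ a.2) \ O) ≠ 4 := fun h => hOf (mem_filter.2 ⟨mem_powerset.2 hOQ2, hO0, h⟩)
          rw [show (∑ R ∈ (a.1 ∪ a.2).powerset, (if F.lab R = 4 ∧ c.1 ⊆ R ∧ R ⊆ (a.1 ∪ a.2) \ O then (1 : ZMod 2) else 0)) = 0 from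
            sum_eq_zero fun R _ => if_neg fun h => hO4 (F.lab_eq_four_of_subset h.2.2 h.1), mul_zero]
        · rw [F.crossM_eq_zero_of_lab_ne (a.1 ∪ a.2) (Y := a.2) hO0, zero_mul]
      · rw [show (∑ R' ∈ (a.1 ∪ a.2).powerset, (if F.lab R' = 0 ∧ O ⊆ R' ∧ R' ⊆ a.2 then (1 : ZMod 2) else 0)) = 0 from
          sum_eq_zero fun R' _ => if_neg fun h => hOQ2 (h.2.1.trans h.2.2), zero_mul]
    rw [hsum5]
    exact (Finset.sum_subset (fun O hO => mem_powerset.2 ((mem_powerset.1 (mem_filter.1 hO).1).trans subset_union_right)) hvan).trans key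
  · rw [if_neg hPQ, zero_mul]

/-- **COROLLARY: independence away from incomparable defects** (this work).  Let `X` be a set of rainbows such that
`⟨certFun a, rbVec c⟩ = 0` for all `a ≠ c` in `X` that are INCOMPARABLE in the product order.  Then `{rbVec c}_{c ∈ X}` is linearly
independent: `k_a` kills every `rbVec c` with `c` not strictly above `a` (`certFun_rbVec_below` and the hypothesis) and reads `rbVec a` as `1`,
so the leading-term lemma (weight `|Q1| + |Q3|`) applies.  In particular any `RbBelow`-chain of rainbows has independent two-stage vectors. [this work] -/
theorem rbVec_linearIndependent_of_certFun_incomparable (X : Finset (Finset α × Finset α)) (hX : X ⊆ F.rainbows)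
    (hinc : ∀ a ∈ X, ∀ c ∈ X, a ≠ c → ¬ RbBelow a c → ¬ RbBelow c a → (∑ σ ∈ F.sup, F.certFun a σ * F.rbVec c σ) = 0) :
    LinearIndependent (ZMod 2) (fun ρ : ↥X => fun σ : ↥F.sup => F.rbVec ρ.1 σ.1) := by
  classical
  refine linearIndependent_of_not_mem_span_adm (K := ZMod 2) X (fun ρ => fun σ : ↥F.sup => F.rbVec ρ σ.1)
    (fun ρ => ρ.1.card + ((ρ.1 ∪ ρ.2)ᶜ).card) (fun ρ ρ' => ¬ RbBelow ρ ρ') ?_ ?_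
  · intro i _ j _ _ hadm
    rw [not_not] at hadm
    exact RbBelow.weight_lt hadm
  · intro a haX hmem
    have ha : a ∈ F.dem := (mem_filter.1 (hX haX)).1
    have har : F.IsRainbow a := (mem_filter.1 (hX haX)).2
    -- the functional `v ↦ Σ_σ certFun a σ · v σ` vanishes on the admissible generators and is `1` on `rbVec a`
    let L : (↥F.sup → ZMod 2) →ₗ[ZMod 2] ZMod 2 :=
      { toFun := fun v => ∑ σ : ↥F.sup, F.certFun a σ.1 * v σ
        map_add' := fun v w => by
          simp only [Pi.add_apply, mul_add, Finset.sum_add_distrib]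
        map_smul' := fun r v => by
          simp only [Pi.smul_apply, smul_eq_mul, RingHom.id_apply, Finset.mul_sum]
          exact Finset.sum_congr rfl fun σ _ => by ring }
    have hL1 : L (fun σ : ↥F.sup => F.rbVec a σ.1) = 1 := by
      show (∑ σ : ↥F.sup, F.certFun a σ.1 * F.rbVec a σ.1) = 1
      rw [Finset.sum_coe_sort F.sup (fun σ => F.certFun a σ * F.rbVec a σ)]
      exact F.certFun_rbVec_diag ha har
    have hL0 : ∀ v ∈ (fun ρ => fun σ : ↥F.sup => F.rbVec ρ σ.1) '' {j | j ∈ X ∧ j ≠ a ∧ ¬ RbBelow a j}, L v = 0 := by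
      rintro v ⟨c, ⟨hcX, hca, hnab⟩, rfl⟩
      have hc : c ∈ F.dem := (mem_filter.1 (hX hcX)).1
      have hcr : F.IsRainbow c := (mem_filter.1 (hX hcX)).2
      show (∑ σ : ↥F.sup, F.certFun a σ.1 * F.rbVec c σ.1) = 0
      rw [Finset.sum_coe_sort F.sup (fun σ => F.certFun a σ * F.rbVec c σ)]
      by_cases hcb : RbBelow c a
      · exact F.certFun_rbVec_below ha har hc hcr hcb
      · exact hinc a haX c hcX (Ne.symm hca) hnab hcb
    have hspan : ∀ v ∈ Submodule.span (ZMod 2)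
        ((fun ρ => fun σ : ↥F.sup => F.rbVec ρ σ.1) '' {j | j ∈ X ∧ j ≠ a ∧ ¬ RbBelow a j}), L v = 0 := by
      intro v hv
      have : Submodule.span (ZMod 2) ((fun ρ => fun σ : ↥F.sup => F.rbVec ρ σ.1) '' {j | j ∈ X ∧ j ≠ a ∧ ¬ RbBelow a j})
          ≤ LinearMap.ker L := by
        rw [Submodule.span_le]
        intro w hw
        exact LinearMap.mem_ker.2 (hL0 w hw)
      exact LinearMap.mem_ker.1 (this hv)
    have h0 := hspan _ hmem
    rw [hL1] at h0
    exact one_ne_zero h0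

/-- **★ for sunflowers without incomparable certificate defects** (this work): if `⟨certFun a, rbVec c⟩ = 0` for all incomparable rainbows
`a ≠ c`, then `RainbowKernelIndependence` holds for this sunflower and hence `0 ≤ ZH` (gen 20's `ZH_nonneg_of_rbVec_linearIndependent`). [this work] -/
theorem ZH_nonneg_of_certFun_incomparable
    (hinc : ∀ a ∈ F.rainbows, ∀ c ∈ F.rainbows, a ≠ c → ¬ RbBelow a c → ¬ RbBelow c a →
      (∑ σ ∈ F.sup, F.certFun a σ * F.rbVec c σ) = 0) :
    0 ≤ F.ZH :=
  F.ZH_nonneg_of_rbVec_linearIndependent (F.rbVec_linearIndependent_of_certFun_incomparable F.rainbows subset_rfl hinc)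

end Sunflower

end Summit.CriticalPhenomena.PercolationContinuityZ3.Theorems.SunflowerPartition
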